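import Summits.QuantumFields.YangMills.Theses.ConvexGribovBody
import Summits.QuantumFields.YangMills.Theorems.ConvexGribovBodyBrascampLiebVacuumStubPairIneq
import Summits.QuantumFields.YangMills.Theorems.ConvexGribovBodyBrascampLiebVacuumStubAbsSqrt
import Summits.QuantumFields.YangMills.Theorems.ConvexGribovBodyBrascampLiebVacuumStubRpHankel
import Summits.QuantumFields.YangMills.Theorems.ConvexGribovBodyBrascampLiebVacuumStubPolyaSzego
import Summits.QuantumFields.YangMills.Theorems.ConvexGribovBodyBrascampLiebVacuumStubMomentCone
import Literature.MathematicalPhysics.QuantumFieldTheory.LatticeGaugeProofs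

/-!
# Stub `stub_thermalSqrt` of the crux `BrascampLiebVacuum` (line `SketchIdeator2`)

The thermal reflection-positivity square root. For Wilson's four-dimensional lattice gauge
measure `μ = wilsonMeasure r.ρ β` on the torus `(ℤ/L)⁴`, `L = 2S+1`, `β ≥ 0`, every compact group
`G` with lattice representation `r`, every `S`, and every link-Lipschitz function `f` of the
time-zero spatial links (`τ_t` = translation by `t` units of Euclidean time, `m = E_μ f`,
`G(t) = E_μ (f - m)(f ∘ τ_t - m)`, `Var = G(0)`, `c(f) = E_μ (f - f ∘ τ₁)²`,
`b(f) = Σ_{t<L} G(t)`):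

  `Var_μ f ≤ 3 √(c(f) · b(f)) + 4 b(f) / (2S+1)`.

Mechanism: Osterwalder–Seiler positivity on the odd torus together with time-translation
invariance gives a symmetric autocovariance `G` whose two truncated Hankel forms are positive
semi-definite and `c = 2G(0) - 2G(1)` (`stub_rpHankel`); the truncated moment cone
(`stub_momentCone`) puts `G` in the closed cone of the pair sequences `u ↦ (q^u + q^{L-u})/2`,
`q ∈ [0,1]`; on each pair sequence the per-pair inequality `stub_pairIneq` holds, Cauchy–Schwarz
over the finite non-negative combination (`stub_absSqrt`) sums up, and finally `ε → 0` over the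
closed cone. The `4b/L` term is the exact finite-temperature (period-`L`) correction replacing the
sup-norm remainder of the zero-temperature form `Var² ≤ ½ c b`.

Riders (necessity of the zero-mode stub: the crux implies `stub_zeroMode` with the same constant):

* `zeroMode_autocov_le_var`: `G(t) ≤ G(0) = Var_μ f` for every `t` — pointwise `2xy ≤ x² + y²`
  plus time-translation invariance `E_μ (g ∘ τ_t)² = E_μ g²` (`rpHankel_integral_shift`);
* `susceptibility_le_card_mul_var`: `b(f) ≤ L · Var_μ f`;
* `stub_zeroMode_of_crux`: the crux `BrascampLiebVacuum` (`Var_μ f ≤ C · Dmax · dir f`) implies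
  the zero-mode stub `b(f) ≤ C · L · Dmax · dir f` with the same constant `C`, the same `β₀` and
  the same `S₀(β)`.
-/

open scoped BigOperators Topology Matrix
open Filter MeasureTheory
open Literature.MathematicalPhysics.QuantumFieldTheory

noncomputable section

namespace Summit.QuantumFields.YangMills.Theorems.BrascampLiebVacuum

/-! ### The thermal reflection-positivity square root (proved from the landed stubs) -/

/-- **Stub (MATHEMATICS, proved — thermal reflection-positivity square root).**
`Var_μ f ≤ 3 √(c(f) b(f)) + 4 b(f) / (2S+1)` for link-Lipschitz functions of the time-zero spatial
links, `β ≥ 0`: `stub_rpHankel` feeds `stub_momentCone`; on the resulting finite pair decomposition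
`Var`, `c`, `b` are the combinations of the pair weights of `stub_pairIneq`, and `stub_absSqrt` sums
up; then `ε → 0` over the closed cone. The `4b/L` term is the exact finite-temperature (period-`L`)
correction replacing the uncontrollable sup-norm remainder of the zero-temperature form
`Var² ≤ ½ c b`. [folklore] -/
theorem stub_thermalSqrt :
    ∀ (G : Type) [Group G] [TopologicalSpace G] [IsTopologicalGroup G] [CompactSpace G]
      [MeasurableSpace G] [BorelSpace G] (r : LatticeRep G) (β : ℝ), 0 ≤ β → ∀ (S : ℕ),
      let μ := wilsonMeasure (d := 4) (L := 2 * S + 1) r.ρ β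
      let fro : Matrix (Fin r.N) (Fin r.N) ℂ → ℝ := fun M => ∑ a, ∑ b, ‖M a b‖ ^ 2
      let τ : ℕ → GaugeConfig 4 (2 * S + 1) G → GaugeConfig 4 (2 * S + 1) G :=
        fun t U e => U (e.1 + Pi.single 0 ((t : ℕ) : ZMod (2 * S + 1)), e.2)
      ∀ f : GaugeConfig 4 (2 * S + 1) G → ℝ,
        (∀ U V : GaugeConfig 4 (2 * S + 1) G,
          (∀ e : Edge 4 (2 * S + 1), e.1 0 = 0 → e.2 ≠ 0 → U e = V e) → f U = f V) →
        (∃ K : ℝ, ∀ U V : GaugeConfig 4 (2 * S + 1) G,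
          |f U - f V| ≤ K * ∑ e, Real.sqrt (fro (r.ρ (U e) - r.ρ (V e)))) →
        ∫ U, (f U - ∫ V, f V ∂μ) ^ 2 ∂μ ≤
          3 * Real.sqrt ((∫ U, (f U - f (τ 1 U)) ^ 2 ∂μ) *
                (∑ t ∈ Finset.range (2 * S + 1),
                  ∫ U, (f U - ∫ V, f V ∂μ) * (f (τ t U) - ∫ V, f V ∂μ) ∂μ)) +
            4 * (∑ t ∈ Finset.range (2 * S + 1),
                  ∫ U, (f U - ∫ V, f V ∂μ) * (f (τ t U) - ∫ V, f V ∂μ) ∂μ) / (2 * S + 1 : ℝ) := by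
  intro G _ _ _ _ _ _ r β hβ S μ fro τ f hf₂ hf₃
  obtain ⟨hsym, hH0, hH1, hc⟩ := stub_rpHankel G r β hβ S f hf₂ hf₃
  set Gf : ℕ → ℝ := fun u => ∫ U, (f U - ∫ V, f V ∂μ) * (f (τ u U) - ∫ V, f V ∂μ) ∂μ with hGf
  have hL : (0 : ℝ) < (2 * S + 1 : ℝ) := by positivity
  have hL1 : 1 ≤ 2 * S + 1 := by omega
  have hcast : ((2 * S + 1 : ℕ) : ℝ) = (2 * S + 1 : ℝ) := by push_cast; ring
  -- `τ 0 = id`, so `Var = Gf 0`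
  have hτ0 : ∀ U : GaugeConfig 4 (2 * S + 1) G, τ 0 U = U := by
    intro U; funext e; simp [τ]
  have hVar : ∫ U, (f U - ∫ V, f V ∂μ) ^ 2 ∂μ = Gf 0 := by
    simp only [hGf, hτ0, pow_two]
  rw [hVar, hc]
  -- abbreviations for the three linear functionals of `Gf`
  set B : ℝ := ∑ u ∈ Finset.range (2 * S + 1), Gf u with hB
  -- the approximation scheme: for every ε > 0 the bound holds up to O(ε)
  have approx : ∀ ε : ℝ, 0 < ε →
      Gf 0 ≤ ε + 3 * Real.sqrt ((2 * Gf 0 - 2 * Gf 1 + 4 * ε) * (B + (2 * S + 1 : ℝ) * ε)) +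
        4 * (B + (2 * S + 1 : ℝ) * ε) / (2 * S + 1 : ℝ) := by
    intro ε hε
    obtain ⟨n, t, q, ht, hq, hrep⟩ := stub_momentCone S Gf hsym hH0 hH1 ε hε
    -- pair weights
    set v : ℕ → ℝ := fun k => (1 + q k ^ (2 * S + 1)) / 2 with hv
    set γ : ℕ → ℝ := fun k => 1 + q k ^ (2 * S + 1) - q k - q k ^ (2 * S + 1 - 1) with hγ
    set βw : ℕ → ℝ := fun k =>
      ∑ u ∈ Finset.range (2 * S + 1), (q k ^ u + q k ^ (2 * S + 1 - u)) / 2 with hβw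
    have key : ∀ k < n, 0 ≤ v k ∧ 0 ≤ γ k ∧ 0 ≤ βw k ∧
        v k ≤ 3 * Real.sqrt (γ k * βw k) + 4 * βw k / (2 * S + 1 : ℝ) := by
      intro k hk
      have h := stub_pairIneq (2 * S + 1) hL1 (q k) (hq k hk).1 (hq k hk).2
      rw [hcast] at h
      exact h
    have habs := stub_absSqrt (2 * S + 1 : ℝ) hL n t v γ βw ht (fun k hk => (key k hk).1)
      (fun k hk => (key k hk).2.1) (fun k hk => (key k hk).2.2.1) (fun k hk => (key k hk).2.2.2)
    -- the three approximate identities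
    have e0 := hrep 0 (Nat.zero_le _)
    have e1 := hrep 1 hL1
    have hV : Gf 0 ≤ ∑ k ∈ Finset.range n, t k * v k + ε := by
      have := (abs_sub_le_iff.1 e0).1
      have hsum : ∑ k ∈ Finset.range n, t k * ((q k ^ 0 + q k ^ (2 * S + 1 - 0)) / 2) =
          ∑ k ∈ Finset.range n, t k * v k :=
        Finset.sum_congr rfl fun k _ => by simp [hv, add_comm]
      linarith
    have hC : ∑ k ∈ Finset.range n, t k * γ k ≤ 2 * Gf 0 - 2 * Gf 1 + 4 * ε := by
      have h0 := (abs_sub_le_iff.1 e0).2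
      have h1 := (abs_sub_le_iff.1 e1).1
      have hsum : ∑ k ∈ Finset.range n, t k * γ k =
          2 * ∑ k ∈ Finset.range n, t k * ((q k ^ 0 + q k ^ (2 * S + 1 - 0)) / 2) -
            2 * ∑ k ∈ Finset.range n, t k * ((q k ^ 1 + q k ^ (2 * S + 1 - 1)) / 2) := by
        rw [Finset.mul_sum, Finset.mul_sum, ← Finset.sum_sub_distrib]
        refine Finset.sum_congr rfl fun k _ => ?_
        simp only [hγ, pow_zero, pow_one, Nat.sub_zero]
        ring
      linarith
    have hBε : ∑ k ∈ Finset.range n, t k * βw k ≤ B + (2 * S + 1 : ℝ) * ε := by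
      have hswap : ∑ k ∈ Finset.range n, t k * βw k =
          ∑ u ∈ Finset.range (2 * S + 1),
            ∑ k ∈ Finset.range n, t k * ((q k ^ u + q k ^ (2 * S + 1 - u)) / 2) := by
        rw [Finset.sum_comm]
        refine Finset.sum_congr rfl fun k _ => ?_
        rw [hβw, Finset.mul_sum]
      rw [hswap, hB]
      have hterm : ∀ u ∈ Finset.range (2 * S + 1),
          ∑ k ∈ Finset.range n, t k * ((q k ^ u + q k ^ (2 * S + 1 - u)) / 2) ≤ Gf u + ε := by
        intro u hu
        have := (abs_sub_le_iff.1 (hrep u (le_of_lt (Finset.mem_range.1 hu)))).2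
        linarith
      calc ∑ u ∈ Finset.range (2 * S + 1),
            ∑ k ∈ Finset.range n, t k * ((q k ^ u + q k ^ (2 * S + 1 - u)) / 2)
          ≤ ∑ u ∈ Finset.range (2 * S + 1), (Gf u + ε) := Finset.sum_le_sum hterm
        _ = (∑ u ∈ Finset.range (2 * S + 1), Gf u) + (2 * S + 1 : ℝ) * ε := by
          rw [Finset.sum_add_distrib, Finset.sum_const, Finset.card_range]
          ring
    -- signs of the approximants
    have hCn : 0 ≤ ∑ k ∈ Finset.range n, t k * γ k :=
      Finset.sum_nonneg fun k hk => mul_nonneg (ht k (Finset.mem_range.1 hk))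
        (key k (Finset.mem_range.1 hk)).2.1
    have hBn : 0 ≤ ∑ k ∈ Finset.range n, t k * βw k :=
      Finset.sum_nonneg fun k hk => mul_nonneg (ht k (Finset.mem_range.1 hk))
        (key k (Finset.mem_range.1 hk)).2.2.1
    have hsqrt : Real.sqrt ((∑ k ∈ Finset.range n, t k * γ k) * (∑ k ∈ Finset.range n, t k * βw k))
        ≤ Real.sqrt ((2 * Gf 0 - 2 * Gf 1 + 4 * ε) * (B + (2 * S + 1 : ℝ) * ε)) :=
      Real.sqrt_le_sqrt (mul_le_mul hC hBε hBn (hCn.trans hC))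
    have hdiv : 4 * (∑ k ∈ Finset.range n, t k * βw k) / (2 * S + 1 : ℝ) ≤
        4 * (B + (2 * S + 1 : ℝ) * ε) / (2 * S + 1 : ℝ) := by
      gcongr
    linarith
  -- let ε → 0⁺
  set φ : ℝ → ℝ := fun ε => ε + 3 * Real.sqrt ((2 * Gf 0 - 2 * Gf 1 + 4 * ε) *
      (B + (2 * S + 1 : ℝ) * ε)) + 4 * (B + (2 * S + 1 : ℝ) * ε) / (2 * S + 1 : ℝ) with hφ
  have hcont : Continuous φ := by
    have h1 : Continuous fun ε : ℝ => (2 * Gf 0 - 2 * Gf 1 + 4 * ε) * (B + (2 * S + 1 : ℝ) * ε) :=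
      by fun_prop
    have h2 : Continuous fun ε : ℝ => 4 * (B + (2 * S + 1 : ℝ) * ε) / (2 * S + 1 : ℝ) := by
      fun_prop
    exact (continuous_id.add (continuous_const.mul (Real.continuous_sqrt.comp h1))).add h2
  have hlim : Tendsto φ (𝓝[>] 0) (𝓝 (φ 0)) :=
    (hcont.tendsto 0).mono_left nhdsWithin_le_nhds
  have hev : ∀ᶠ ε in 𝓝[>] (0 : ℝ), Gf 0 ≤ φ ε :=
    eventually_nhdsWithin_of_forall fun ε hε => approx ε hε
  have hle : Gf 0 ≤ φ 0 := ge_of_tendsto hlim hev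
  have hφ0 : φ 0 = 3 * Real.sqrt ((2 * Gf 0 - 2 * Gf 1) * B) + 4 * B / (2 * S + 1 : ℝ) := by
    simp [hφ]
  rw [hφ0] at hle
  exact hle

/-! ### Riders: necessity of the zero-mode stub -/

section Wilson

variable {L : ℕ} [NeZero L] {G : Type*} [Group G] [TopologicalSpace G] [IsTopologicalGroup G]
  [CompactSpace G] [MeasurableSpace G] [BorelSpace G]

/-- **Autocovariance ≤ variance.** For a bounded measurable real `g` on Wilson's torus and a time
shift `σ z`, `E_μ g · (g ∘ σ_z) ≤ E_μ g²`: pointwise `2xy ≤ x² + y²`, then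
`E_μ (g ∘ σ_z)² = E_μ g²` by time-translation invariance (`rpHankel_integral_shift`). [folklore] -/
theorem zeroMode_autocov_le_var {N : ℕ} {ρ : G →* Matrix (Fin N) (Fin N) ℂ} (hρ : Continuous ρ)
    (β : ℝ) (σ : ZMod L → GaugeConfig 4 L G → GaugeConfig 4 L G)
    (hσ : ∀ z U e, σ z U e = U (e.1 + Pi.single 0 z, e.2)) (z : ZMod L)
    {g : GaugeConfig 4 L G → ℝ} (hgm : Measurable g) {Cg : ℝ} (hgb : ∀ U, |g U| ≤ Cg) :
    ∫ U, g U * g (σ z U) ∂(wilsonMeasure ρ β) ≤ ∫ U, g U ^ 2 ∂(wilsonMeasure ρ β) := by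
  haveI := isProbabilityMeasure_wilsonMeasure (d := 4) (L := L) ρ hρ β
  have hσm : Measurable fun U => g (σ z U) := hgm.comp (rpHankel_measurable_shift σ hσ z)
  have h1 : Integrable (fun U => g U * g U) (wilsonMeasure ρ β) :=
    rpHankel_integrable_mul hgm hgm hgb hgb
  have h2 : Integrable (fun U => g (σ z U) * g (σ z U)) (wilsonMeasure ρ β) :=
    rpHankel_integrable_mul hσm hσm (fun U => hgb _) fun U => hgb _
  have h12 : Integrable (fun U => g U * g (σ z U)) (wilsonMeasure ρ β) :=
    rpHankel_integrable_mul hgm hσm hgb fun U => hgb _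
  have hshift : ∫ U, g (σ z U) * g (σ z U) ∂(wilsonMeasure ρ β) =
      ∫ U, g U * g U ∂(wilsonMeasure ρ β) :=
    rpHankel_integral_shift ρ β σ hσ z (fun U => g U * g U)
  have hpt : ∀ U, g U * g (σ z U) ≤ (g U * g U + g (σ z U) * g (σ z U)) / 2 := fun U => by
    nlinarith [sq_nonneg (g U - g (σ z U))]
  calc ∫ U, g U * g (σ z U) ∂(wilsonMeasure ρ β)
      ≤ ∫ U, (g U * g U + g (σ z U) * g (σ z U)) / 2 ∂(wilsonMeasure ρ β) :=
        integral_mono h12 ((h1.add h2).div_const 2) hpt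
    _ = ∫ U, g U ^ 2 ∂(wilsonMeasure ρ β) := by
        rw [integral_div, integral_add h1 h2, hshift]
        simp_rw [pow_two]
        ring

end Wilson

/-- **Susceptibility ≤ period × variance.** For every compact group `G` with lattice
representation `r`, every `β`, every torus `(2S+1)⁴` and every link-Lipschitz function `f` of the
time-zero spatial links, the zero-frequency susceptibility
`b(f) = Σ_{t<2S+1} E_μ (f - m)(f ∘ τ_t - m)` (`τ_t U (x, j) = U (x + t e₀, j)`, `m = E_μ f`) is at
most `(2S+1) · Var_μ f`: each autocovariance is at most the variance
(`zeroMode_autocov_le_var`). (The locality hypothesis is not used.) [folklore] -/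
theorem susceptibility_le_card_mul_var :
    ∀ (G : Type) [Group G] [TopologicalSpace G] [IsTopologicalGroup G] [CompactSpace G]
      [MeasurableSpace G] [BorelSpace G] (r : LatticeRep G) (β : ℝ) (S : ℕ),
      let μ := wilsonMeasure (d := 4) (L := 2 * S + 1) r.ρ β
      let fro : Matrix (Fin r.N) (Fin r.N) ℂ → ℝ := fun M => ∑ a, ∑ b, ‖M a b‖ ^ 2
      let τ : ℕ → GaugeConfig 4 (2 * S + 1) G → GaugeConfig 4 (2 * S + 1) G :=
        fun t U e => U (e.1 + Pi.single 0 ((t : ℕ) : ZMod (2 * S + 1)), e.2)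
      ∀ f : GaugeConfig 4 (2 * S + 1) G → ℝ,
        (∀ U V : GaugeConfig 4 (2 * S + 1) G,
          (∀ e : Edge 4 (2 * S + 1), e.1 0 = 0 → e.2 ≠ 0 → U e = V e) → f U = f V) →
        (∃ K : ℝ, ∀ U V : GaugeConfig 4 (2 * S + 1) G,
          |f U - f V| ≤ K * ∑ e, Real.sqrt (fro (r.ρ (U e) - r.ρ (V e)))) →
        (∑ t ∈ Finset.range (2 * S + 1),
            ∫ U, (f U - ∫ V, f V ∂μ) * (f (τ t U) - ∫ V, f V ∂μ) ∂μ) ≤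
          (2 * S + 1 : ℝ) * ∫ U, (f U - ∫ V, f V ∂μ) ^ 2 ∂μ := by
  intro G _ _ _ _ _ _ r β S μ fro τ f _ hf
  haveI : SecondCountableTopology G :=
    (r.continuous.isClosedEmbedding r.injective).isEmbedding.secondCountableTopology
  have hfc : Continuous f := rpHankel_continuous r (by simpa only [fro] using hf)
  obtain ⟨Cf, hCf⟩ := rpHankel_bounded hfc
  have hgm : Measurable fun U => f U - ∫ V, f V ∂μ := hfc.measurable.sub_const _
  have hgb : ∀ U, |f U - ∫ V, f V ∂μ| ≤ Cf + |∫ V, f V ∂μ| := fun U =>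
    (abs_sub _ _).trans (add_le_add (hCf U) le_rfl)
  have hle : ∀ t ∈ Finset.range (2 * S + 1),
      ∫ U, (f U - ∫ V, f V ∂μ) * (f (τ t U) - ∫ V, f V ∂μ) ∂μ ≤
        ∫ U, (f U - ∫ V, f V ∂μ) ^ 2 ∂μ := fun t _ =>
    zeroMode_autocov_le_var (L := 2 * S + 1) (g := fun U => f U - ∫ V, f V ∂μ) r.continuous β
      (fun z U e => U (e.1 + Pi.single 0 z, e.2)) (fun _ _ _ => rfl) (t : ZMod (2 * S + 1)) hgm hgb
  calc (∑ t ∈ Finset.range (2 * S + 1),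
          ∫ U, (f U - ∫ V, f V ∂μ) * (f (τ t U) - ∫ V, f V ∂μ) ∂μ)
      ≤ ∑ t ∈ Finset.range (2 * S + 1), ∫ U, (f U - ∫ V, f V ∂μ) ^ 2 ∂μ := Finset.sum_le_sum hle
    _ = (2 * S + 1 : ℝ) * ∫ U, (f U - ∫ V, f V ∂μ) ^ 2 ∂μ := by
        rw [Finset.sum_const, Finset.card_range, nsmul_eq_mul]
        push_cast
        ring

/-- **The zero-mode stub follows from the crux** (necessity of `stub_zeroMode`): if
`Var_μ f ≤ C · Dmax · dir f` for all admissible `f` (`BrascampLiebVacuum`, with its `β₀` and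
`S₀(β)`), then `b(f) ≤ C · (2S+1) · Dmax · dir f` with the same `C`, `β₀`, `S₀`, because
`b(f) ≤ (2S+1) · Var_μ f` (`susceptibility_le_card_mul_var`). [folklore] -/
theorem stub_zeroMode_of_crux :
    Summit.QuantumFields.YangMills.Theses.ConvexGribovBody.BrascampLiebVacuum →
    ∀ (G : Type) [Group G] [TopologicalSpace G] [IsTopologicalGroup G] [CompactSpace G]
      [MeasurableSpace G] [BorelSpace G], IsCompactSimpleLieGroup G → ∀ r : LatticeRep G,
      ∃ C_B : ℝ, 0 < C_B ∧ ∃ β₀ : ℝ, ∀ β : ℝ, β₀ ≤ β → ∃ S₀ : ℕ, ∀ S : ℕ, S₀ ≤ S →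
      let μ := wilsonMeasure (d := 4) (L := 2 * S + 1) r.ρ β
      let fro : Matrix (Fin r.N) (Fin r.N) ℂ → ℝ := fun M => ∑ a, ∑ b, ‖M a b‖ ^ 2
      let coul : GaugeConfig 4 (2 * S + 1) G → (Site 4 (2 * S + 1) → G) → ℝ := fun U h =>
        -∑ e : Edge 4 (2 * S + 1),
          (if e.1 0 = 0 ∧ e.2 ≠ 0 then (r.ρ (gaugeTransform h U e)).trace.re else 0)
      let cov : GaugeConfig 4 (2 * S + 1) G → (Site 4 (2 * S + 1) → G) →
          (Fin 3 → ZMod (2 * S + 1)) → ℝ := fun U h p =>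
        (∑ j : Fin 3, fro (∑ y : Fin 3 → ZMod (2 * S + 1),
          Complex.exp (-(2 * Real.pi * Complex.I *
            (∑ i : Fin 3, ((p i).val : ℂ) * ((y i).val : ℂ)) / (2 * S + 1 : ℂ))) •
          ((1 / 2 : ℂ) • (r.ρ (gaugeTransform h U (Fin.cons (0 : ZMod (2 * S + 1)) y, j.succ)) -
            (r.ρ (gaugeTransform h U (Fin.cons (0 : ZMod (2 * S + 1)) y, j.succ)))ᴴ)))) /
          ((2 * S + 1 : ℝ) ^ 3)
      let Dmax : ℝ := ⨆ p : Fin 3 → ZMod (2 * S + 1),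
        ∫ U, (⨆ h : {h : Site 4 (2 * S + 1) → G // ∀ h', coul U h ≤ coul U h'}, cov U h.1 p) ∂μ
      let slope : (GaugeConfig 4 (2 * S + 1) G → ℝ) → GaugeConfig 4 (2 * S + 1) G →
          Edge 4 (2 * S + 1) → ℝ := fun f U e =>
        Filter.limsup (fun g : G => |f (Function.update U e g) - f U| /
          Real.sqrt (fro (r.ρ g - r.ρ (U e)))) (𝓝[≠] (U e))
      let dir : (GaugeConfig 4 (2 * S + 1) G → ℝ) → ℝ := fun f =>
        ∑ e : Edge 4 (2 * S + 1), (if e.1 0 = 0 ∧ e.2 ≠ 0 then ∫ U, (slope f U e) ^ 2 ∂μ else 0)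
      let τ : ℕ → GaugeConfig 4 (2 * S + 1) G → GaugeConfig 4 (2 * S + 1) G :=
        fun t U e => U (e.1 + Pi.single 0 ((t : ℕ) : ZMod (2 * S + 1)), e.2)
      ∀ f : GaugeConfig 4 (2 * S + 1) G → ℝ, IsGaugeInvariant f →
        (∀ U V : GaugeConfig 4 (2 * S + 1) G,
          (∀ e : Edge 4 (2 * S + 1), e.1 0 = 0 → e.2 ≠ 0 → U e = V e) → f U = f V) →
        (∃ K : ℝ, ∀ U V : GaugeConfig 4 (2 * S + 1) G,
          |f U - f V| ≤ K * ∑ e, Real.sqrt (fro (r.ρ (U e) - r.ρ (V e)))) →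
        (∑ t ∈ Finset.range (2 * S + 1),
            ∫ U, (f U - ∫ V, f V ∂μ) * (f (τ t U) - ∫ V, f V ∂μ) ∂μ) ≤
          C_B * (2 * S + 1 : ℝ) * Dmax * dir f := by
  intro h G _ _ _ _ _ _ hG r
  obtain ⟨C, hC, β₀, hβ⟩ := h G hG r
  refine ⟨C, hC, β₀, fun β hb => ?_⟩
  obtain ⟨S₀, hS⟩ := hβ β hb
  refine ⟨S₀, fun S hS' => ?_⟩
  intro μ fro coul cov Dmax slope dir τ f hf₁ hf₂ hf₃
  have hV : ∫ U, (f U - ∫ V, f V ∂μ) ^ 2 ∂μ ≤ C * Dmax * dir f := hS S hS' f hf₁ hf₂ hf₃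
  have hb : (∑ t ∈ Finset.range (2 * S + 1),
      ∫ U, (f U - ∫ V, f V ∂μ) * (f (τ t U) - ∫ V, f V ∂μ) ∂μ) ≤
        (2 * S + 1 : ℝ) * ∫ U, (f U - ∫ V, f V ∂μ) ^ 2 ∂μ :=
    susceptibility_le_card_mul_var G r β S f hf₂ hf₃
  have hL : (0 : ℝ) ≤ (2 * S + 1 : ℝ) := by positivity
  calc (∑ t ∈ Finset.range (2 * S + 1),
          ∫ U, (f U - ∫ V, f V ∂μ) * (f (τ t U) - ∫ V, f V ∂μ) ∂μ)
      ≤ (2 * S + 1 : ℝ) * ∫ U, (f U - ∫ V, f V ∂μ) ^ 2 ∂μ := hb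
    _ ≤ (2 * S + 1 : ℝ) * (C * Dmax * dir f) := mul_le_mul_of_nonneg_left hV hL
    _ = C * (2 * S + 1 : ℝ) * Dmax * dir f := by ring

end Summit.QuantumFields.YangMills.Theorems.BrascampLiebVacuum

end
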